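import Summits.NavierStokesRegularity.NavierStokesRegularity.Theorems.HeredityFromTwo.Negative.NoSwirlSlice

/-!
# The SLICE-form GLOBAL-SOLUTION lever: a tower realisation's slice never launches a global
# finite-energy classical flow; under `HeredityFrom k₀` (`k₀ ≥ 1`) — in particular item 19250
# `HeredityFromTwo` — every registered readout slice is an UNFORCED BLOW-UP DATUM (kernel, fact-free)

Cell `ns-blowup`, seat `ns-blowup-refuter5` (g0), K-row K5-13. NEGATIVE-LANE support for the route item
`PalasekTowerBreakdown.HeredityFromTwo` (`:= HeredityFrom 2`, stmt-NavierStokesRegularity-19250); the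
common generalisation of the DATUM-form global lever (refuter g12 KJ-10/KJ-11,
`Realisation.not_exists_global_classical`, `HeredityFrom.false_of_global_classical`: the DESIGN
`(u₀, f)` is not globally solvable) and of the SLICE-form no-swirl lever (ns-blowup-lean g9 p456896 /
K5-11 R1 `NoSwirlSlice.lean`). LABEL: kernel bookkeeping (Tao's forced unconditional uniqueness and
the lifespan algebra `IsMaximalSmoothSolution.translate` are theorems of the tree); nothing is
constructed; every premise class below is empty-in-practice (no registered stage at any level `≥ 1` is
known: K61 / S-RING-1 / P-RING-0…2 CLOSED). WHAT THIS IS NOT: not Navier–Stokes evidence either way.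

§1 `Realisation` (any rates `R`, any `ν > 0`):
* `Realisation.memLp_two_slice` — every slice `W.u t₀`, `t₀ ∈ [0, T)`, is `H¹` (Tao's class);
* `Realisation.eq_translate_of_global_classical_slice` — a finite-energy classical flow on `[0, ∞)`
  of the RESTARTED problem (force `W.f (· + t₀)`, datum `W.u t₀`) IS the translated tower flow on
  `[0, T − t₀)` (forced uniqueness from the `H¹` slice);
* `Realisation.not_global_classical_slice` — hence no such global flow exists (it would extend the
  translated maximal solution, `isMaximalSmoothSolution.translate`, past its lifespan `T − t₀`);
* `…_of_force_zero` / `Realisation.not_exists_claySolution_slice` — when the force vanishes from `t₀`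
  on, the slice `W.u t₀` has NO global finite-energy classical solution of the UNFORCED system (Clay
  dress included); `Realisation.false_of_clayA_of_slice_decay` — so under Clay (A) no quiet-era slice
  of a realisation has Fefferman's rapid decay (4) (conditional bookkeeping, neither side asserted).

§2 Register (wide rates, `ν = 1`), under `HeredityFrom k₀`, `k₀ ≥ 1`, for ONE registered level-`k₀`
stage `s` of a pinned (`Λ = 8`, `θ = 6/5`) rigid quiet design (preparation force on `[0, τ₁)`
unrestricted): `HeredityFrom.no_global_slice` — the readout slice `s.u (τ k₀)` launches NO global
finite-energy classical solution of the unforced system, i.e. it is a smooth `H^∞` blow-up datum;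
packaged `not_heredityFrom_of_global_slice`; `HeredityFrom.false_of_clayA_of_slice_decay` — with Clay
(A) such a stage cannot have a rapidly decaying readout slice. §3 by the route's decl names: item 19250
ALONE (`k₀ ≥ 2`, `HeredityFrom.mono`) and the parent 19178 `EpisodeInduction` (`k₀ ≥ 1`).

The no-swirl slice lever is the special case «the slice is axisymmetric swirl-free» only morally: the
tree's Ladyzhenskaya–Ukhovskii–Yudovich theorem wants a rapidly decaying datum, which a slice need
not be — g9's a-priori route (`Realisation.not_noSwirl_slice`) avoids that and stays the reference.

References: T. Tao, Anal. PDE 6 (2013), Cor. 11.4 [cite: Tao2011, Cor. 11.4]; J. T. Beale, T. Kato,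
A. Majda, Comm. Math. Phys. 94 (1984), §1 [cite: BealeKatoMajda1984, §1]; C. Fefferman, Clay problem
description (2006), (A) [cite: FeffermanClay2006, (A)]; S. Palasek, arXiv:2605.13827 §4
[cite: Palasek2026ElementaryModel, §4].
-/

noncomputable section

namespace Summit.NavierStokesRegularity.FluidComputer.PalasekTowerClayBridge

open Set MeasureTheory Filter Topology Function
open scoped ENNReal ContDiff NNReal
open Literature.Analysis.FluidPDE
open Summit.NavierStokesRegularity.NavierStokesRegularity.Theorems

/-! ## §1 Slices of a realisation launch no global classical flow -/

namespace Realisation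

variable {ν : ℝ} {R : TowerRates} (W : Realisation ν R)

/-- `u(t₀), ∇u(t₀) ∈ L²` from continuity and finite `∫⁻ ‖D⁰‖²`, `∫⁻ ‖D¹‖²` (as in g9's
`PalasekTowerBreakdownNoSwirlSliceLever`, where the lemma is private). [folklore] -/
private theorem memLp_two_of_iteratedFDeriv_bounds
    {v : EuclideanSpace ℝ (Fin 3) → EuclideanSpace ℝ (Fin 3)}
    (hv : ContDiff ℝ 1 v) (h0 : ∫⁻ x, ‖iteratedFDeriv ℝ 0 v x‖ₑ ^ 2 < ⊤)
    (h1 : ∫⁻ x, ‖iteratedFDeriv ℝ 1 v x‖ₑ ^ 2 < ⊤) :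
    MemLp v 2 volume ∧ MemLp (fderiv ℝ v) 2 volume := by
  have hvc : Continuous v := hv.continuous
  have hDc : Continuous (fderiv ℝ v) := hv.continuous_fderiv one_ne_zero
  have e0 : ∫⁻ x, ‖v x‖ₑ ^ 2 = ∫⁻ x, ‖iteratedFDeriv ℝ 0 v x‖ₑ ^ 2 :=
    lintegral_congr fun x => by rw [← ofReal_norm, ← ofReal_norm, norm_iteratedFDeriv_zero]
  have e1 : ∫⁻ x, ‖fderiv ℝ v x‖ₑ ^ 2 = ∫⁻ x, ‖iteratedFDeriv ℝ 1 v x‖ₑ ^ 2 :=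
    lintegral_congr fun x => by
      rw [← ofReal_norm, ← ofReal_norm, ← norm_iteratedFDeriv_fderiv, norm_iteratedFDeriv_zero]
  refine ⟨(memLp_two_iff_integrable_sq_norm hvc.aestronglyMeasurable).2
      (integrable_sq_norm_of_lintegral_lt_top hvc (by rw [e0]; exact h0)),
    (memLp_two_iff_integrable_sq_norm hDc.aestronglyMeasurable).2
      (integrable_sq_norm_of_lintegral_lt_top hDc (by rw [e1]; exact h1))⟩

/-- **Every slice of a realisation is `H¹`**: `W.u t₀, ∇(W.u t₀) ∈ L²` for `t₀ ∈ [0, T)` (one energy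
bound on `[0, T)` by Tao's forced energy inequality, then Tao's spatial class on the closed sub-slab
`[0, (t₀ + T)/2]`). [cite: Tao2011, Cor. 11.4] -/
theorem memLp_two_slice (hν : 0 < ν) {t₀ : ℝ} (ht₀ : t₀ ∈ Ico 0 W.T) :
    MemLp (W.u t₀) 2 volume ∧ MemLp (fderiv ℝ (W.u t₀)) 2 volume := by
  have hT : 0 < W.T := W.T_pos
  obtain ⟨E, hEt, hE, -⟩ := energy_dissipation_le_of_clayForce hν hT W.classical W.force_smooth
    W.force_decay W.energy
  set t₁ : ℝ := (t₀ + W.T) / 2 with ht₁def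
  have ht₁0 : 0 < t₁ := by rw [ht₁def]; linarith [ht₀.1, ht₀.2]
  have ht₁T : t₁ < W.T := by rw [ht₁def]; linarith [ht₀.2]
  have ht₀m : t₀ ∈ Icc 0 t₁ := ⟨ht₀.1, by rw [ht₁def]; linarith [ht₀.2]⟩
  have hTao : HasBoundedSobolevNormsOn (Icc 0 t₁) W.u :=
    (W.classical_Icc ht₁0 ht₁T).hasBoundedSobolevNormsOn_of_clayForce hν ht₁0
      ⟨E.toNNReal, fun t ht =>
        (hE t ⟨ht.1, ht.2.trans_lt ht₁T⟩).trans (ENNReal.coe_toNNReal hEt.ne).ge⟩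
      W.datum_decay W.force_smooth W.force_decay
  obtain ⟨C₀, hC₀⟩ := hTao 0
  obtain ⟨C₁, hC₁⟩ := hTao 1
  have hu1 : ContDiff ℝ 1 (W.u t₀) :=
    ((W.classical_Icc ht₁0 ht₁T).contDiff_velocity ht₀m).of_le (by norm_cast)
  exact memLp_two_of_iteratedFDeriv_bounds hu1 ((hC₀ t₀ ht₀m).trans_lt ENNReal.coe_lt_top)
    ((hC₁ t₀ ht₀m).trans_lt ENNReal.coe_lt_top)

/-- **A global finite-energy classical flow RESTARTED FROM A SLICE is the translated tower flow**: if
`(v, q)` solves the forced system with the restarted force `W.f (· + t₀)` classically on `[0, ∞)` with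
bounded energy and `v 0 = W.u t₀` (`t₀ ∈ [0, T)`), then `v t = W.u (t + t₀)` for `t ∈ [0, T − t₀)`
(Tao's forced unconditional uniqueness on `[0, t]` from the `H¹` slice; the restarted force is again of
Clay class, `IsSmoothOnHalfSpace.timeShift` / `HasRapidSpaceTimeDecay.timeShift`).
[cite: Tao2011, Cor. 11.4] -/
theorem eq_translate_of_global_classical_slice (hν : 0 < ν) {t₀ : ℝ} (ht₀ : t₀ ∈ Ico 0 W.T)
    {v : ℝ → EuclideanSpace ℝ (Fin 3) → EuclideanSpace ℝ (Fin 3)}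
    {q : ℝ → EuclideanSpace ℝ (Fin 3) → ℝ}
    (hv : IsClassicalNSSolutionOn (Ici 0) ν (fun t => W.f (t + t₀)) v q) (h0 : v 0 = W.u t₀)
    (hE : HasBoundedEnergy v) :
    ∀ t ∈ Ico 0 (W.T - t₀), v t = W.u (t + t₀) := by
  intro t ht
  obtain ⟨ht0, htT⟩ := ht
  rcases ht0.eq_or_lt with h00 | ht0'
  · subst h00
    rw [zero_add]
    exact h0
  · obtain ⟨hL2, hH1⟩ := W.memLp_two_slice hν ht₀
    have hfs : IsSmoothOnHalfSpace (fun s => W.f (s + t₀)) := W.force_smooth.timeShift ht₀.1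
    have hfd : HasRapidSpaceTimeDecay (fun s => W.f (s + t₀)) :=
      HasRapidSpaceTimeDecay.timeShift W.force_smooth W.force_decay ht₀.1
    have hu' : IsClassicalNSSolutionOn (Icc 0 t) ν (fun s => W.f (s + t₀))
        (fun s => W.u (s + t₀)) (fun s => W.p (s + t₀)) :=
      (W.classical.comp_add_right t₀).mono
        (fun s hs => ⟨by linarith [hs.1, ht₀.1], by linarith [hs.2]⟩) (uniqueDiffOn_Icc ht0')
    have hv' : IsClassicalNSSolutionOn (Icc 0 t) ν (fun s => W.f (s + t₀)) v q :=
      hv.mono (fun s hs => hs.1) (uniqueDiffOn_Icc ht0')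
    have hEv : ∃ C : ℝ≥0∞, C < ⊤ ∧ ∀ s ∈ Icc 0 t, ∫⁻ x, ‖v s x‖ₑ ^ 2 ≤ C := by
      obtain ⟨C, hC, hb⟩ := hE
      exact ⟨C, hC, fun s hs => hb s hs.1⟩
    have hEu : ∃ C : ℝ≥0∞, C < ⊤ ∧ ∀ s ∈ Icc 0 t, ∫⁻ x, ‖W.u (s + t₀) x‖ₑ ^ 2 ≤ C := by
      obtain ⟨C, hC, hb⟩ := W.energy (t + t₀) (by linarith)
      exact ⟨C, hC, fun s hs => hb (s + t₀) ⟨by linarith [hs.1, ht₀.1], by linarith [hs.2]⟩⟩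
    exact tao_unconditional_uniqueness_velocity_forced_holds ν t hν ht0' (W.u t₀) hL2 hH1
      (fun s => W.f (s + t₀)) hfs hfd v (fun s => W.u (s + t₀)) q (fun s => W.p (s + t₀)) hv' hu'
      h0 (by simp) hEv hEu t ⟨ht0, le_rfl⟩

/-- **NO SLICE OF A REALISATION LAUNCHES A GLOBAL FINITE-ENERGY CLASSICAL FLOW** (any rates, any
`ν > 0`; kernel): for `t₀ ∈ [0, T)` there is no classical solution on `[0, ∞)` of the restarted problem
(force `W.f (· + t₀)`, datum `W.u t₀`) with bounded energy — it would be the translated tower flow on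
`[0, T − t₀)` (`eq_translate_of_global_classical_slice`) and so extend the translated MAXIMAL smooth
solution (`isMaximalSmoothSolution.translate`) past its lifespan. At `t₀ = 0` this is KJ-10's
`not_exists_global_classical`. [cite: BealeKatoMajda1984, §1] [cite: Tao2011, Cor. 11.4] -/
theorem not_global_classical_slice (hν : 0 < ν) {t₀ : ℝ} (ht₀ : t₀ ∈ Ico 0 W.T) :
    ¬ ∃ (v : ℝ → EuclideanSpace ℝ (Fin 3) → EuclideanSpace ℝ (Fin 3))
        (q : ℝ → EuclideanSpace ℝ (Fin 3) → ℝ),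
        IsClassicalNSSolutionOn (Ici 0) ν (fun t => W.f (t + t₀)) v q ∧ v 0 = W.u t₀ ∧
          HasBoundedEnergy v := by
  rintro ⟨v, q, hv, h0, hE⟩
  have heq := W.eq_translate_of_global_classical_slice hν ht₀ hv h0 hE
  rcases ht₀.1.eq_or_lt with h00 | ht₀'
  · subst h00
    refine W.not_exists_global_classical hν ⟨v, q, ?_, by simpa using h0, hE⟩
    simpa using hv
  · exact (W.isMaximalSmoothSolution.translate ht₀' ht₀.2).2
      ⟨W.T - t₀ + 1, by linarith, v, q, hv.mono (fun s hs => hs.1) (uniqueDiffOn_Ico _ _), heq⟩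

/-- **A slice in a FORCE-FREE era launches no global finite-energy classical flow of the UNFORCED
system**: if `W.f t = 0` for all `t ≥ t₀` (`t₀ ∈ [0, T)`; e.g. the quiet era of a registered design),
then the datum `W.u t₀` has no classical solution on `[0, ∞)` of the unforced system with bounded
energy. [cite: Tao2011, Cor. 11.4] -/
theorem not_global_classical_slice_of_force_zero (hν : 0 < ν) {t₀ : ℝ} (ht₀ : t₀ ∈ Ico 0 W.T)
    (hf : ∀ t : ℝ, t₀ ≤ t → W.f t = 0) :
    ¬ ∃ (v : ℝ → EuclideanSpace ℝ (Fin 3) → EuclideanSpace ℝ (Fin 3))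
        (q : ℝ → EuclideanSpace ℝ (Fin 3) → ℝ),
        IsClassicalNSSolutionOn (Ici 0) ν 0 v q ∧ v 0 = W.u t₀ ∧ HasBoundedEnergy v := by
  rintro ⟨v, q, hv, h0, hE⟩
  refine W.not_global_classical_slice hν ht₀ ⟨v, q, hv.congr_force fun t ht x => ?_, h0, hE⟩
  have h : W.f (t + t₀) = 0 := hf (t + t₀) (le_add_of_nonneg_left (mem_Ici.1 ht))
  simp [h]

/-- The same in Clay dress: **a force-free-era slice of a realisation has NO global Clay-class solution
of the unforced system** (`IsSmoothOnHalfSpace`, `IsNavierStokesSolution ν 0`, `HasBoundedEnergy`;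
`isNavierStokesSolution_and_smooth_iff`). [cite: FeffermanClay2006, (A)] [cite: Tao2011, Cor. 11.4] -/
theorem not_exists_claySolution_slice (hν : 0 < ν) {t₀ : ℝ} (ht₀ : t₀ ∈ Ico 0 W.T)
    (hf : ∀ t : ℝ, t₀ ≤ t → W.f t = 0) :
    ¬ ∃ (v : ℝ → EuclideanSpace ℝ (Fin 3) → EuclideanSpace ℝ (Fin 3))
        (q : ℝ → EuclideanSpace ℝ (Fin 3) → ℝ),
        IsSmoothOnHalfSpace v ∧ IsSmoothOnHalfSpace q ∧ IsNavierStokesSolution ν 0 (W.u t₀) v q ∧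
          HasBoundedEnergy v := by
  rintro ⟨v, q, hv, hq, hns, hE⟩
  have hcl := isNavierStokesSolution_and_smooth_iff.1 ⟨hns, hv, hq⟩
  exact W.not_global_classical_slice_of_force_zero hν ht₀ hf ⟨v, q, hcl.1, hcl.2, hE⟩

/-- **Under Clay (A) no force-free-era slice of a realisation has Fefferman's rapid decay (4)** —
such a slice would be a Clay datum with a global smooth bounded-energy unforced solution
(`not_exists_claySolution_slice`). Conditional bookkeeping; neither side asserted.
[cite: FeffermanClay2006, (A)] -/
theorem false_of_clayA_of_slice_decay (hA : _root_.NavierStokesRegularity) (hν : 0 < ν) {t₀ : ℝ}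
    (ht₀ : t₀ ∈ Ico 0 W.T) (hf : ∀ t : ℝ, t₀ ≤ t → W.f t = 0)
    (hdec : HasRapidSpatialDecay (W.u t₀)) : False := by
  obtain ⟨v, q, hv, hq, hns, hE⟩ := hA ν hν (W.u t₀) (W.classical.contDiff_velocity ht₀)
    (W.classical.divFree t₀ ht₀) hdec
  exact W.not_exists_claySolution_slice hν ht₀ hf ⟨v, q, hv, hq, hns, hE⟩

end Realisation

/-! ## §2 The register: under `HeredityFrom k₀` every registered readout slice is a blow-up datum -/

section Lever

variable {S : Schedule TowerRates.wide}

/-- **`HeredityFrom k₀` (`k₀ ≥ 1`) makes every registered readout slice an UNFORCED BLOW-UP DATUM**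
(kernel, no named fact, no cap, no symmetry, preparation force unrestricted): given `HeredityFrom k₀`
and a registered level-`k₀` stage `s` of a pinned rigid quiet wide design, the slice `s.u (τ k₀)` has
NO classical solution on `[0, ∞)` of the unforced system with bounded energy. Proof: the design reaches
every level (`HeredityFrom.nonempty_stage_all`), so it realises the tower with its own design
(`Schedule.exists_realisation_of_nonempty_stages`); the stage IS the realisation's flow on `[0, τ k₀]`
(forced uniqueness) and the force vanishes from `τ₁ ≤ τ k₀` on; apply
`Realisation.not_global_classical_slice_of_force_zero`. [cite: Tao2011, Cor. 11.4]
[cite: Palasek2026ElementaryModel, §4] -/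
theorem HeredityFrom.no_global_slice {k₀ : ℕ} (h : HeredityFrom k₀) (hP : S.Pins 8 (6 / 5))
    (hR : S.Rigid) (hQ : S.Quiet) (hk₀ : 1 ≤ k₀)
    (s : Stage 1 TowerRates.wide S (Margins.routeG TowerRates.wide) k₀) :
    ¬ ∃ (v : ℝ → EuclideanSpace ℝ (Fin 3) → EuclideanSpace ℝ (Fin 3))
        (q : ℝ → EuclideanSpace ℝ (Fin 3) → ℝ),
        IsClassicalNSSolutionOn (Ici 0) 1 0 v q ∧ v 0 = s.u (S.τ k₀) ∧ HasBoundedEnergy v := by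
  rintro ⟨v, q, hv, h0, hE⟩
  obtain ⟨W, hWf, hW0, hWT⟩ :=
    S.exists_realisation_of_nonempty_stages one_pos (h.nonempty_stage_all hP hR hQ s)
  -- the stage is the realisation's flow on `[0, τ k₀]`
  have hτT : S.τ k₀ < W.T := by rw [hWT]; exact S.τ_lt_T k₀
  set T' : ℝ := (S.τ k₀ + W.T) / 2 with hT'def
  have hT'0 : 0 < T' := by rw [hT'def]; linarith [S.τ_pos k₀]
  have hT'T : T' < W.T := by rw [hT'def]; linarith
  have hτT' : S.τ k₀ ≤ T' := by rw [hT'def]; linarith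
  have hU : IsClassicalNSSolutionOn (Icc 0 T') 1 S.f W.u W.p := by
    rw [← hWf]
    exact W.classical_Icc hT'0 hT'T
  have heq : s.u (S.τ k₀) = W.u (S.τ k₀) :=
    palasekTowerBreakdown_stage_velocity_eq_solution_rates one_pos s hτT' hU hW0 (W.energy T' hT'T)
      (S.τ k₀) ⟨(S.τ_pos k₀).le, le_rfl⟩
  -- quiet era: the force vanishes on `[τ k₀, ∞) ⊆ [τ 1, ∞)`
  have hf : ∀ t : ℝ, S.τ k₀ ≤ t → W.f t = 0 := fun t ht => by
    rw [hWf]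
    exact hQ t ((S.τ_mono hk₀).trans ht)
  exact W.not_global_classical_slice_of_force_zero one_pos ⟨(S.τ_pos k₀).le, hτT⟩ hf
    ⟨v, q, hv, h0.trans heq, hE⟩

/-- **The slice-form global lever at starting level `k₀ ≥ 1`, packaged**: ONE registered level-`k₀`
stage of a pinned rigid quiet wide design whose readout slice launches a global finite-energy
classical solution of the unforced system refutes `HeredityFrom k₀`. Premise empty-in-practice.
[cite: Tao2011, Cor. 11.4] [cite: Palasek2026ElementaryModel, §4] -/
theorem not_heredityFrom_of_global_slice {k₀ : ℕ} (hk₀ : 1 ≤ k₀)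
    (hW : ∃ (S : Schedule TowerRates.wide)
      (s : Stage 1 TowerRates.wide S (Margins.routeG TowerRates.wide) k₀)
      (v : ℝ → EuclideanSpace ℝ (Fin 3) → EuclideanSpace ℝ (Fin 3))
      (q : ℝ → EuclideanSpace ℝ (Fin 3) → ℝ),
      S.Pins 8 (6 / 5) ∧ S.Rigid ∧ S.Quiet ∧
        IsClassicalNSSolutionOn (Ici 0) 1 0 v q ∧ v 0 = s.u (S.τ k₀) ∧ HasBoundedEnergy v) :
    ¬ HeredityFrom k₀ := by
  rintro h
  obtain ⟨S, s, v, q, hP, hR, hQ, hv, h0, hE⟩ := hW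
  exact h.no_global_slice hP hR hQ hk₀ s ⟨v, q, hv, h0, hE⟩

/-- **Clay (A) and `HeredityFrom k₀` (`k₀ ≥ 1`) forbid a rapidly decaying readout slice on any
registered level-`k₀` stage** of a pinned rigid quiet wide design (the slice would be a Clay datum;
`HeredityFrom.no_global_slice`). Conditional bookkeeping; neither side asserted; compare KJ-11's
`HeredityFrom.isEmpty_unforced_stage_of_clayA` (UNFORCED designs, datum form).
[cite: FeffermanClay2006, (A)] -/
theorem HeredityFrom.false_of_clayA_of_slice_decay (hA : _root_.NavierStokesRegularity) {k₀ : ℕ}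
    (h : HeredityFrom k₀) (hP : S.Pins 8 (6 / 5)) (hR : S.Rigid) (hQ : S.Quiet) (hk₀ : 1 ≤ k₀)
    (s : Stage 1 TowerRates.wide S (Margins.routeG TowerRates.wide) k₀)
    (hsm : ContDiff ℝ ∞ (s.u (S.τ k₀))) (hdiv : NSWave0.IsDivFree (s.u (S.τ k₀)))
    (hdec : HasRapidSpatialDecay (s.u (S.τ k₀))) : False := by
  obtain ⟨v, q, hv, hq, hns, hE⟩ := hA 1 one_pos (s.u (S.τ k₀)) hsm hdiv hdec
  have hcl := isNavierStokesSolution_and_smooth_iff.1 ⟨hns, hv, hq⟩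
  exact h.no_global_slice hP hR hQ hk₀ s ⟨v, q, hcl.1, hcl.2, hE⟩

end Lever

end Summit.NavierStokesRegularity.FluidComputer.PalasekTowerClayBridge

/-! ## §3 By the route's decl names -/

namespace Summit.NavierStokesRegularity.PalasekTowerBreakdownNegative

open Set
open Summit.NavierStokesRegularity.NavierStokesRegularity.Theses
open Summit.NavierStokesRegularity.FluidComputer.PalasekTowerClayBridge
open Literature.Analysis.FluidPDE

/-- **Item 19250 `PalasekTowerBreakdown.HeredityFromTwo` ALONE is refuted by ONE registered stage at
a level `k₀ ≥ 2` of a pinned rigid quiet wide design whose readout slice `s.u (τ k₀)` launches a global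
finite-energy classical solution of the unforced system** — route decl by name; kernel, no named fact,
no cap, no symmetry (body: `HeredityFrom.mono` + `HeredityFrom.no_global_slice`). Premise
empty-in-practice. [cite: Tao2011, Cor. 11.4] [cite: Palasek2026ElementaryModel, §4] -/
theorem palasekTowerBreakdown_not_heredityFromTwo_of_global_slice
    (hW : ∃ (S : Schedule TowerRates.wide) (k₀ : ℕ)
      (s : Stage 1 TowerRates.wide S (Margins.routeG TowerRates.wide) k₀)
      (v : ℝ → EuclideanSpace ℝ (Fin 3) → EuclideanSpace ℝ (Fin 3))
      (q : ℝ → EuclideanSpace ℝ (Fin 3) → ℝ),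
      2 ≤ k₀ ∧ S.Pins 8 (6 / 5) ∧ S.Rigid ∧ S.Quiet ∧
        IsClassicalNSSolutionOn (Ici 0) 1 0 v q ∧ v 0 = s.u (S.τ k₀) ∧ HasBoundedEnergy v) :
    ¬ PalasekTowerBreakdown.HeredityFromTwo := by
  rintro hH
  obtain ⟨S, k₀, s, v, q, hk₀, hP, hR, hQ, hv, h0, hE⟩ := hW
  exact (HeredityFrom.mono hH hk₀).no_global_slice hP hR hQ (le_trans (by norm_num) hk₀) s
    ⟨v, q, hv, h0, hE⟩

/-- **Under item 19250 every registered readout slice at a level `k ≥ 2` is an unforced blow-up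
datum** (contrapositive reading: no global finite-energy classical unforced flow from `s.u (τ k)`).
[cite: Tao2011, Cor. 11.4] -/
theorem palasekTowerBreakdown_heredityFromTwo_no_global_slice
    (hH : PalasekTowerBreakdown.HeredityFromTwo) {S : Schedule TowerRates.wide}
    (hP : S.Pins 8 (6 / 5)) (hR : S.Rigid) (hQ : S.Quiet) {k : ℕ} (hk : 2 ≤ k)
    (s : Stage 1 TowerRates.wide S (Margins.routeG TowerRates.wide) k) :
    ¬ ∃ (v : ℝ → EuclideanSpace ℝ (Fin 3) → EuclideanSpace ℝ (Fin 3))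
        (q : ℝ → EuclideanSpace ℝ (Fin 3) → ℝ),
        IsClassicalNSSolutionOn (Ici 0) 1 0 v q ∧ v 0 = s.u (S.τ k) ∧ HasBoundedEnergy v :=
  (HeredityFrom.mono hH hk).no_global_slice hP hR hQ (le_trans (by norm_num) hk) s

/-- **The parent item 19178 `PalasekTowerBreakdown.EpisodeInduction` (`= HeredityFrom 1`) is refuted by
ONE registered stage at a level `k₀ ≥ 1` whose readout slice launches a global finite-energy classical
unforced flow** (route decl by name; `episodeInductionG_iff_heredityFrom_one`). Premise
empty-in-practice. [cite: Tao2011, Cor. 11.4] [cite: Palasek2026ElementaryModel, §4] -/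
theorem palasekTowerBreakdown_not_episodeInduction_of_global_slice
    (hW : ∃ (S : Schedule TowerRates.wide) (k₀ : ℕ)
      (s : Stage 1 TowerRates.wide S (Margins.routeG TowerRates.wide) k₀)
      (v : ℝ → EuclideanSpace ℝ (Fin 3) → EuclideanSpace ℝ (Fin 3))
      (q : ℝ → EuclideanSpace ℝ (Fin 3) → ℝ),
      1 ≤ k₀ ∧ S.Pins 8 (6 / 5) ∧ S.Rigid ∧ S.Quiet ∧
        IsClassicalNSSolutionOn (Ici 0) 1 0 v q ∧ v 0 = s.u (S.τ k₀) ∧ HasBoundedEnergy v) :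
    ¬ PalasekTowerBreakdown.EpisodeInduction := by
  rintro hH
  obtain ⟨S, k₀, s, v, q, hk₀, hP, hR, hQ, hv, h0, hE⟩ := hW
  exact ((episodeInductionG_iff_heredityFrom_one.1 hH).mono hk₀).no_global_slice hP hR hQ hk₀ s
    ⟨v, q, hv, h0, hE⟩

end Summit.NavierStokesRegularity.PalasekTowerBreakdownNegative

end
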